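import Mathlib

/-!
# Joint eigenbases of commuting Hermitian matrices (route GelfandPairHosts, helper for item
RankFormula, stmt-MatrixMultiplication-7385)

`exists_joint_eigenbasis`: a set `S` of pairwise commuting Hermitian matrices in `ℂ^{X×X}`
(`X` finite) admits an orthonormal basis `(u_s)` of `ℂ^X` of joint eigenvectors, stated in
matrix form: `∑_s u_s u_s^* = 1`, `u_s^* u_s = 1` and `H u_s = χ_s(H) u_s` for all `H ∈ S`.  This is Mathlib's
`LinearMap.IsSymmetric.directSum_isInternal_of_pairwise_commute` (joint eigenspace
decomposition on `EuclideanSpace ℂ X`) followed by `DirectSum.IsInternal.collectedOrthonormalBasis`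
and a translation back to matrices; no definitions are declared.
-/

set_option linter.dupNamespace false

noncomputable section

namespace Summit.MatrixMultiplication.MatrixMultiplication.Theorems

open scoped BigOperators InnerProductSpace
open Matrix Module Module.End WithLp

namespace GelfandRankFormula

variable {X : Type} [Fintype X] [DecidableEq X]

/-- **Joint eigenbasis of commuting Hermitian matrices, matrix form.**  For a set `S` of
pairwise commuting Hermitian `X × X` complex matrices there are finitely many vectors
`u_s ∈ ℂ^X` with `∑_s u_s u_s^* = 1`, `u_s^* u_s = 1` (an orthonormal basis) that are joint
eigenvectors:
`H u_s = χ_s(H) u_s` for every `H ∈ S`. -/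
theorem exists_joint_eigenbasis (S : Set (Matrix X X ℂ)) (hS : ∀ H ∈ S, H.IsHermitian)
    (hcomm : ∀ H ∈ S, ∀ H' ∈ S, H * H' = H' * H) :
    ∃ (ι : Type) (_ : Fintype ι) (u : ι → X → ℂ) (χ : ι → Matrix X X ℂ → ℂ),
      (∑ s, Matrix.vecMulVec (u s) (star (u s)) = 1) ∧ (∀ s, star (u s) ⬝ᵥ u s = 1) ∧
      ∀ s, ∀ H ∈ S, H *ᵥ u s = χ s H • u s := by
  classical
  -- the commuting family of symmetric operators on `EuclideanSpace ℂ X`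
  set T : S → (EuclideanSpace ℂ X →ₗ[ℂ] EuclideanSpace ℂ X) :=
    fun H => Matrix.toEuclideanLin (H : Matrix X X ℂ) with hTdef
  have hT : ∀ H, (T H).IsSymmetric := fun H =>
    Matrix.isSymmetric_toEuclideanLin_iff.2 (hS H H.2)
  have hC : Pairwise (Function.onFun Commute T) := by
    intro H H' _
    change T H * T H' = T H' * T H
    simp only [hTdef, Module.End.mul_eq_comp, Matrix.toEuclideanLin, ← Matrix.toLpLin_mul_same]
    rw [hcomm H H.2 H' H'.2]
  have hInt := LinearMap.IsSymmetric.directSum_isInternal_of_pairwise_commute hT hC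
  set V : (S → ℂ) → Submodule ℂ (EuclideanSpace ℂ X) := fun α => ⨅ j, eigenspace (T j) (α j)
    with hVdef
  have hOF : OrthogonalFamily ℂ (fun α => V α) fun α => (V α).subtypeₗᵢ :=
    LinearMap.IsSymmetric.orthogonalFamily_iInf_eigenspaces hT
  -- restrict to the finitely many non-zero joint eigenspaces
  haveI : Fintype {α : S → ℂ // V α ≠ ⊥} :=
    hInt.submodule_iSupIndep.fintypeNeBotOfFiniteDimensional
  have hInt₀ : DirectSum.IsInternal (fun α : {α : S → ℂ // V α ≠ ⊥} => V α.1) :=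
    DirectSum.isInternal_ne_bot_iff.2 hInt
  have hOF₀ : OrthogonalFamily ℂ (fun α : {α : S → ℂ // V α ≠ ⊥} => V α.1)
      fun α => (V α.1).subtypeₗᵢ := hOF.comp Subtype.val_injective
  set b := hInt₀.collectedOrthonormalBasis hOF₀ fun α => stdOrthonormalBasis ℂ (V α.1) with hbdef
  have hbmem : ∀ s, b s ∈ V s.1.1 := fun s => hInt₀.collectedOrthonormalBasis_mem hOF₀ _ s
  refine ⟨_, inferInstance, fun s => ofLp (b s),
    fun s H => if hH : H ∈ S then s.1.1 ⟨H, hH⟩ else 0, ?_, ?_, ?_⟩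
  · -- `∑_s u_s u_s^* = 1` from `∑_s ⟪b_s, v⟫ b_s = v`
    apply Matrix.toEuclideanLin.injective
    rw [Matrix.toEuclideanLin, Matrix.toLpLin_one]
    refine LinearMap.ext fun v => ?_
    conv_rhs => rw [LinearMap.id_apply, ← b.sum_repr' v]
    rw [map_sum, LinearMap.sum_apply]
    refine Finset.sum_congr rfl fun s _ => ?_
    apply WithLp.ofLp_injective 2
    rw [Matrix.ofLp_toLpLin, Matrix.toLin'_apply, Matrix.vecMulVec_mulVec, op_smul_eq_smul,
      WithLp.ofLp_smul, EuclideanSpace.inner_eq_star_dotProduct, dotProduct_comm]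
  · -- unit vectors
    intro s
    have h1 := (orthonormal_iff_ite.1 b.orthonormal) s s
    rw [if_pos rfl, EuclideanSpace.inner_eq_star_dotProduct, dotProduct_comm] at h1
    exact h1
  · intro s H hH
    beta_reduce
    rw [dif_pos hH]
    have h1 := (Submodule.mem_iInf _).1 (hbmem s) ⟨H, hH⟩
    rw [Module.End.mem_eigenspace_iff] at h1
    have h2 := congrArg ofLp h1
    rw [WithLp.ofLp_smul] at h2
    rw [← h2, hTdef]
    simp only [Matrix.toEuclideanLin, Matrix.ofLp_toLpLin, Matrix.toLin'_apply]

end GelfandRankFormula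

end Summit.MatrixMultiplication.MatrixMultiplication.Theorems
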